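import Mathlib
import Literature.Computability.AlgebraicComplexity.FixedPointLog
import Summits.RiemannHypothesis.RiemannHypothesis.Theorems.WeilFormatCPrimeFormBound
import Summits.RiemannHypothesis.RiemannHypothesis.Theorems.WeilFormatCPrimeFormJoint
import HarnessLib

/-!
# Format C: PRIME ⪰ −A·1 from a real shift bound over ALL prime powers `n < N` (generic plug-in, any window `e^{2a} ≤ N`)

Helper file (`--supports stmt-RiemannHypothesis-0098`, lead-track anchor; format C far bound), RH-free.  Seat rh-explicit-weil-1 (gen7).
`WeilFormatCPrimeFormJointOf.lean` / `…Of7.lean` turn an explicit five- or seven-term real joint shift bound into hypothesis `hP` of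
`WeilFormatC.farBlock_ge_dhat` (windows below `(log 11)/2`).  This file is the window-independent version that the k-prime cell
certificates of the route-K3 successor (`WeilFormatCKCellCert.lean`, any number of primes) plug into: for every `0 < a`, every `N`
with `e^{2a} ≤ N`, and every real `A` such that

  `Σ_{n < N} 2·(Λ(n)/√n) · ∫ u(x − log n) u(x) dx ≤ A · ∫ u²`   (all real measurable bounded `u` vanishing off `[−a, a]`),

* `WeilFormatC.primeCoeff_form_ge_of_shiftBound_range` — **`−A·Σ_{n∈s}|c_n|² ≤ Σ_{n,m∈s} Re(conj c_n c_m)·primeCoeff a n m`**.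

(Terms with `2a ≤ log n` vanish on both sides, so over-long ranges are harmless.)  Standard axioms only; no definitions.
-/

set_option autoImplicit false
set_option linter.dupNamespace false

noncomputable section

open Complex Set MeasureTheory Finset
open scoped Real ComplexConjugate BigOperators ArithmeticFunction.vonMangoldt

namespace Summit.RiemannHypothesis.RiemannHypothesis.Theorems.WeilFormatC

open Literature.NumberTheory.LFunctions Literature.NumberTheory.LFunctions.Yoshida1992

section Range

variable {a : ℝ} {f : ℝ → ℂ}

/-- For `e^{2a} ≤ N`: a sum over `weilPrimeIndex a` of terms vanishing when `2a ≤ log k` is the sum over `k < N`. -/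
theorem sum_weilPrimeIndex_eq_sum_range_of_exp_le {N : ℕ} (hN : Real.exp (2 * a) ≤ N) (F : ℕ → ℝ)
    (hF : ∀ k : ℕ, 2 * a ≤ Real.log k → F k = 0) :
    ∑ k ∈ weilPrimeIndex a, F k = ∑ k ∈ Finset.range N, F k := by
  have hsub : weilPrimeIndex a ⊆ Finset.range N := by
    intro k hk
    have hk' := mem_weilPrimeIndex.1 hk
    rw [Finset.mem_range]
    by_contra hge
    push Not at hge
    have hkN : (N : ℝ) ≤ k := by exact_mod_cast hge
    have hpos : (0 : ℝ) < k := lt_of_lt_of_le (lt_of_lt_of_le (Real.exp_pos _) hN) hkN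
    have : 2 * a ≤ Real.log k := by
      rw [Real.le_log_iff_exp_le hpos]; exact hN.trans hkN
    linarith
  refine Finset.sum_subset hsub fun k _ hk ↦ ?_
  refine hF k ?_
  by_contra hlt
  push Not at hlt
  exact hk (mem_weilPrimeIndex.2 hlt)

/-- **Shift bound over `n < N` for a complex window function from a real one.** -/
theorem re_integral_shift_le_of_range {N : ℕ} {A : ℝ}
    (hJ : ∀ (u : ℝ → ℝ) (C : ℝ), Measurable u → (∀ x, |u x| ≤ C) → (∀ x, x ∉ Icc (-a) a → u x = 0) →
      ∑ n ∈ Finset.range N, 2 * ((Λ n : ℝ) / Real.sqrt n) * (∫ x, u (x - Real.log n) * u x) ≤ A * ∫ x, u x ^ 2)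
    (hf : IsWindowFunction a f) :
    ∑ n ∈ Finset.range N, 2 * ((Λ n : ℝ) / Real.sqrt n) * (∫ x, f (x + Real.log n) * conj (f x)).re
      ≤ A * ∫ x, ‖f x‖ ^ 2 := by
  obtain ⟨S, hS0, hS⟩ := hf.bounded'
  have hre : ∀ x, |(f x).re| ≤ S := fun x ↦ (Complex.abs_re_le_norm _).trans (hS x)
  have him : ∀ x, |(f x).im| ≤ S := fun x ↦ (Complex.abs_im_le_norm _).trans (hS x)
  have hmr : Measurable fun x ↦ (f x).re := Complex.measurable_re.comp hf.measurable
  have hmi : Measurable fun x ↦ (f x).im := Complex.measurable_im.comp hf.measurable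
  have hzr : ∀ x, x ∉ Icc (-a) a → (f x).re = 0 := fun x hx ↦ by rw [hf.eq_zero x hx, Complex.zero_re]
  have hzi : ∀ x, x ∉ Icc (-a) a → (f x).im = 0 := fun x hx ↦ by rw [hf.eq_zero x hx, Complex.zero_im]
  have hu := hJ (fun y ↦ (f y).re) S hmr hre hzr
  have hv := hJ (fun y ↦ (f y).im) S hmi him hzi
  have hsplit : ∀ t : ℝ, (∫ x, f (x + t) * conj (f x)).re =
      (∫ x, (fun y ↦ (f y).re) (x - t) * (fun y ↦ (f y).re) x) +
        ∫ x, (fun y ↦ (f y).im) (x - t) * (fun y ↦ (f y).im) x := by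
    intro t
    rw [re_integral_shift_mul_conj hf t,
      integral_add (integrable_shift_mul_of_window hmr hre hmr hre hzr t)
        (integrable_shift_mul_of_window hmi him hmi him hzi t)]
    simp only
    rw [integral_shift_add_mul_eq_sub (fun y ↦ (f y).re) t, integral_shift_add_mul_eq_sub (fun y ↦ (f y).im) t]
  simp only [hsplit, mul_add, Finset.sum_add_distrib]
  rw [integral_norm_sq_eq_add hf]
  linarith

/-- **PRIME ⪰ −A·1 on every finite set of modes, for every window `0 < a` with `e^{2a} ≤ N` and every constant `A` of a real
shift bound over the prime powers below `N` on `[−a, a]`** (hypothesis `hP` of `WeilFormatC.farBlock_ge_dhat`). -/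
theorem primeCoeff_form_ge_of_shiftBound_range (ha : 0 < a) {N : ℕ} (hN : Real.exp (2 * a) ≤ N) {A : ℝ}
    (hJ : ∀ (u : ℝ → ℝ) (C : ℝ), Measurable u → (∀ x, |u x| ≤ C) → (∀ x, x ∉ Icc (-a) a → u x = 0) →
      ∑ n ∈ Finset.range N, 2 * ((Λ n : ℝ) / Real.sqrt n) * (∫ x, u (x - Real.log n) * u x) ≤ A * ∫ x, u x ^ 2)
    (s : Finset ℤ) (c : ℤ → ℂ) :
    -(A * ∑ n ∈ s, ‖c n‖ ^ 2) ≤ ∑ n ∈ s, ∑ m ∈ s, (conj (c n) * c m).re * primeCoeff a n m := by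
  set f : ℝ → ℂ := ∑ n ∈ s, c n • chi a n with hfdef
  have hf : IsWindowFunction a f := IsWindowFunction.sum s c fun n _ ↦ isWindowFunction_chi ha n
  set X : ℕ → ℝ := fun k ↦ 2 * (∫ x, f (x + Real.log k) * conj (f x)).re with hXdef
  have e : ∑ n ∈ s, ∑ m ∈ s, (conj (c n) * c m).re * primeCoeff a n m
      = ∑ k ∈ weilPrimeIndex a, -((Λ k : ℝ) / Real.sqrt k * X k) := by
    calc ∑ n ∈ s, ∑ m ∈ s, (conj (c n) * c m).re * primeCoeff a n m
        = ∑ n ∈ s, ∑ m ∈ s, ∑ k ∈ weilPrimeIndex a, (Λ k : ℝ) / Real.sqrt k *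
            ((conj (c n) * c m).re * (incrCoeff a (Real.log k) n m - if n = m then 2 else 0)) := by
          refine Finset.sum_congr rfl fun n _ ↦ Finset.sum_congr rfl fun m _ ↦ ?_
          rw [primeCoeff, Finset.mul_sum]
          refine Finset.sum_congr rfl fun k _ ↦ by ring
      _ = ∑ n ∈ s, ∑ k ∈ weilPrimeIndex a, ∑ m ∈ s, (Λ k : ℝ) / Real.sqrt k *
            ((conj (c n) * c m).re * (incrCoeff a (Real.log k) n m - if n = m then 2 else 0)) :=
          Finset.sum_congr rfl fun n _ ↦ Finset.sum_comm
      _ = ∑ k ∈ weilPrimeIndex a, ∑ n ∈ s, ∑ m ∈ s, (Λ k : ℝ) / Real.sqrt k *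
            ((conj (c n) * c m).re * (incrCoeff a (Real.log k) n m - if n = m then 2 else 0)) :=
          Finset.sum_comm
      _ = ∑ k ∈ weilPrimeIndex a, (Λ k : ℝ) / Real.sqrt k *
            ∑ n ∈ s, ∑ m ∈ s, (conj (c n) * c m).re * (incrCoeff a (Real.log k) n m - if n = m then 2 else 0) := by
          refine Finset.sum_congr rfl fun k _ ↦ ?_
          rw [Finset.mul_sum]
          refine Finset.sum_congr rfl fun n _ ↦ ?_
          rw [Finset.mul_sum]
      _ = ∑ k ∈ weilPrimeIndex a, -((Λ k : ℝ) / Real.sqrt k * X k) := by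
          refine Finset.sum_congr rfl fun k hk ↦ ?_
          by_cases hΛ : (Λ k : ℝ) = 0
          · rw [hΛ]; simp
          have hk2 : 2 ≤ k := by
            by_contra h
            have : k = 0 ∨ k = 1 := by omega
            rcases this with rfl | rfl
            · exact hΛ (by simp)
            · exact hΛ (by simp)
          have ht : 0 < Real.log k := Real.log_pos (by exact_mod_cast hk2)
          have ht2 : Real.log k ≤ 2 * a := (mem_weilPrimeIndex.1 hk).le
          rw [sum_sum_re_mul_incrCoeff_sub_two_eq ha s c ht.le ht2, hXdef]
          ring
  have hXzero : ∀ k : ℕ, 2 * a ≤ Real.log k → X k = 0 := by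
    intro k hk
    obtain ⟨S, hS0, hS⟩ := hf.bounded'
    have hre : ∀ x, |(f x).re| ≤ S := fun x ↦ (Complex.abs_re_le_norm _).trans (hS x)
    have him : ∀ x, |(f x).im| ≤ S := fun x ↦ (Complex.abs_im_le_norm _).trans (hS x)
    have hmr : Measurable fun x ↦ (f x).re := Complex.measurable_re.comp hf.measurable
    have hmi : Measurable fun x ↦ (f x).im := Complex.measurable_im.comp hf.measurable
    have hzr : ∀ x, x ∉ Icc (-a) a → (f x).re = 0 := fun x hx ↦ by rw [hf.eq_zero x hx, Complex.zero_re]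
    have hzi : ∀ x, x ∉ Icc (-a) a → (f x).im = 0 := fun x hx ↦ by rw [hf.eq_zero x hx, Complex.zero_im]
    simp only [hXdef]
    rw [re_integral_shift_mul_conj hf,
      integral_add (integrable_shift_mul_of_window hmr hre hmr hre hzr _)
        (integrable_shift_mul_of_window hmi him hmi him hzi _)]
    rw [integral_shift_add_mul_eq_sub (fun y ↦ (f y).re), integral_shift_add_mul_eq_sub (fun y ↦ (f y).im),
      integral_shift_mul_eq_zero_of_le hzr hk, integral_shift_mul_eq_zero_of_le hzi hk]
    ring
  have hsum : ∑ k ∈ weilPrimeIndex a, -((Λ k : ℝ) / Real.sqrt k * X k) =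
      ∑ k ∈ Finset.range N, -((Λ k : ℝ) / Real.sqrt k * X k) :=
    sum_weilPrimeIndex_eq_sum_range_of_exp_le hN _ fun k hk ↦ by rw [hXzero k hk, mul_zero, neg_zero]
  have hjoint := re_integral_shift_le_of_range hJ hf
  have hnorm := integral_norm_sq_sum_smul_chi ha s c
  rw [e, hsum, Finset.sum_neg_distrib, ← hnorm]
  have hX : ∑ k ∈ Finset.range N, (Λ k : ℝ) / Real.sqrt k * X k =
      ∑ n ∈ Finset.range N, 2 * ((Λ n : ℝ) / Real.sqrt n) * (∫ x, f (x + Real.log n) * conj (f x)).re :=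
    Finset.sum_congr rfl fun k _ ↦ by simp only [hXdef]; ring
  linarith [hX]

end Range

end Summit.RiemannHypothesis.RiemannHypothesis.Theorems.WeilFormatC
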